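import Literature.Barriers.NavierStokesRegularity.HypodissipativeLerayNonuniquenessDeRosaProofs
import Literature.Barriers.NavierStokesRegularity.HypodissipativeLerayNonuniquenessLocalDeRosa
import Literature.Analysis.FluidPDE.DeRosaPerturbationHolds
import Literature.Analysis.FluidPDE.FracNSShortTimeExistence
import HarnessLib

/-!
# Colombo–De Lellis–De Rosa 2018, Thms. 1.2 and 1.3 — discharged

A sibling proof file (theorems only: no definitions, no named facts) of the barrier entry
`Literature/Barriers/NavierStokesRegularity/HypodissipativeLerayNonuniqueness` (D-0021).

M. Colombo, C. De Lellis, L. De Rosa, *Ill-posedness of Leray solutions for the hypodissipative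
Navier–Stokes equations*, Comm. Math. Phys. 362 (2018) 659–688 = arXiv:1708.05666, §1:
**Thm. 1.2** "Let `α < 1/5`. Then there are initial data `v̄ ∈ L²(𝕋³)` with `div v̄ = 0` for
which there exist infinitely many Leray solutions `v` of (NS) with `v(·,0) = v̄`" (the named fact
`ColomboDeLellisDeRosa2018_thm12` of `HypodissipativeLerayNonuniqueness.lean`) and **Thm. 1.3**
(its local Hölder version: a `C^β` datum, `α < β < 1/5`, a time `T > 0` and infinitely many `C^β`
solutions on `𝕋³ × [0,T]` obeying the energy inequality (3); the named fact
`ColomboDeLellisDeRosa2018_thm13` of `HypodissipativeLerayNonuniquenessProofs.lean`).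

Both are proved here, unconditionally. The route is the one the tree has discharged in full:
the later and stronger prescribed-energy theorem of L. De Rosa, *Infinitely many Leray–Hopf
solutions for the fractional Navier–Stokes equations*, Comm. PDE 44 (2019) 335–365 =
arXiv:1801.10235, Thm. 2.1 (the `1/3`-scheme, whose range `γ < β < 1/3` contains CDLDR's
`α < β < 1/5`), assembled from its gluing stage (§5.2,
`Literature.Analysis.FluidPDE.DeRosa.gluingStage_holds`, `FracNSShortTimeExistence.lean`: the
local theory of §3.2 by the Fourier–Galerkin energy method, Cor. 5.2, Props. 5.3–5.5, the
commutator estimate of Buckmaster–De Lellis–Székelyhidi–Vicol App. D) and its perturbation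
stage (§§5.3–5.5, `Literature.Analysis.FluidPDE.DeRosa.perturbationStage_holds`,
`DeRosaPerturbationHolds.lean`), the mollification stage (`DeRosaMollificationProofs.lean`),
Prop. 4.1 from the three stages (`DeRosaStagesProofs.lean`), the time-regularity step of §4.2
(`DeRosaTimeRegularityProofs.lean`) and the assembly of §2 with Leray's existence theorem (CDLDR
Thm. 1.1, `ColomboDeLellisDeRosa2018_thm11_holds`) being proved in the tree and combined in
`HypodissipativeLerayNonuniquenessDeRosaProofs.lean` (`DeRosa2019_thm21_of_gluing_of_perturbation`,
`ColomboDeLellisDeRosa2018_thm12_of_deRosa_gluing_of_perturbation`) and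
`HypodissipativeLerayNonuniquenessLocalDeRosa.lean`
(`ColomboDeLellisDeRosa2018_thm13_of_deRosa_thm21`: Thm. 1.3 from De Rosa's Thm. 2.1 through
CDLDR's own §2, Cor. 11.2). The paper's own `1/5`-scheme (CDLDR Prop. 3.2, the named fact
`Literature.Analysis.FluidPDE.ColomboDeLellisDeRosa2018_prop32`, with the proved reductions
`ColomboDeLellisDeRosa2018_thm12_of_prop32`, `…_of_stepSpec`) is thereby no longer in the trust
base of either theorem.

* `ColomboDeLellisDeRosa2018_thm12_holds` — **CDLDR Thm. 1.2**, discharged;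
* `ColomboDeLellisDeRosa2018_thm13_holds` — **CDLDR Thm. 1.3**, discharged.

## References

* M. Colombo, C. De Lellis, L. De Rosa, Comm. Math. Phys. 362 (2018) 659–688 =
  arXiv:1708.05666, §1 Thms. 1.1–1.3, §2 (proof of Thms. 1.2–1.3). [`ColomboDelellisDerosa2018`]
* L. De Rosa, Comm. PDE 44 (2019) 335–365 = arXiv:1801.10235, §1 Thm. 1.2, §2 Thm. 2.1 and the
  proof of Thm. 1.2, §3.2 Thm. 3.4 / Prop. 3.5, §4 Prop. 4.1 and §4.2, §5. [`Derosa2018`]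
* T. Buckmaster, C. De Lellis, L. Székelyhidi Jr., V. Vicol, CPAM 72 (2019) 229–274 =
  arXiv:1701.08678, App. D Prop. D.1. [`BuckmasterEtAl2018`]
-/

namespace Literature.Barriers.NavierStokesRegularity

/-- **Colombo–De Lellis–De Rosa 2018, Thm. 1.2, discharged**: for every `α ∈ (0, 1/5)` there is
a divergence-free `v̄ ∈ L²(𝕋³)` which is the datum of infinitely many Leray solutions of
`∂ₜv + div(v ⊗ v) + ∇p + (-Δ)^α v = 0`. Proof: De Rosa 2019, Thm. 1.2 for `γ < 1/3` (from his
Thm. 2.1 — gluing stage `DeRosa.gluingStage_holds` and perturbation stage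
`DeRosa.perturbationStage_holds`, everything else of §§2, 4, 5 proved in the tree — and Leray's
existence theorem, CDLDR Thm. 1.1, `ColomboDeLellisDeRosa2018_thm11_holds`), restricted to
`α < 1/5 < 1/3`. [cite: ColomboDelellisDerosa2018, §1 Thm. 1.2]
[cite: Derosa2018, §1 Thm. 1.2, §2 (proof of Thm. 1.2), §4.2, §5] -/
theorem ColomboDeLellisDeRosa2018_thm12_holds : ColomboDeLellisDeRosa2018_thm12 :=
  ColomboDeLellisDeRosa2018_thm12_of_deRosa_gluing_of_perturbation
    Literature.Analysis.FluidPDE.DeRosa.gluingStage_holds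
    Literature.Analysis.FluidPDE.DeRosa.perturbationStage_holds

/-- **Colombo–De Lellis–De Rosa 2018, Thm. 1.3, discharged**: for `α < 1/5` there are a `C^β`
datum (`α < β < 1/5`), a time `T > 0` and infinitely many `C^β` solutions on `𝕋³ × [0,T]` from
it obeying the energy inequality (3) for all `0 ≤ s ≤ t ≤ T`. Proof: De Rosa 2019, Thm. 2.1
(prescribed energy in the `1/3`-scheme: `DeRosa2019_thm21_of_gluing_of_perturbation` with
`DeRosa.gluingStage_holds`, `DeRosa.perturbationStage_holds`) through CDLDR's own §2
(`ColomboDeLellisDeRosa2018_thm13_of_deRosa_thm21`). [cite: ColomboDelellisDerosa2018, §1 Thm. 1.3, §2]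
[cite: Derosa2018, §2 Thm. 2.1, §4.2, §5] -/
theorem ColomboDeLellisDeRosa2018_thm13_holds : ColomboDeLellisDeRosa2018_thm13 :=
  ColomboDeLellisDeRosa2018_thm13_of_deRosa_thm21
    (DeRosa2019_thm21_of_gluing_of_perturbation
      Literature.Analysis.FluidPDE.DeRosa.gluingStage_holds
      Literature.Analysis.FluidPDE.DeRosa.perturbationStage_holds)

end Literature.Barriers.NavierStokesRegularity
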